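import Summits.QuantumFields.YangMills.Theorems.UnitScaleTiltProp7HessWOfFibreCoreT3Rows
import Summits.QuantumFields.YangMills.Theorems.UnitScaleTiltProp7GeodesicInterp
import Literature.MathematicalPhysics.QuantumFieldTheory.Balaban1983to89.B7Eq31BCH
import HarnessLib

/-!
# Route `UnitScaleTilt`, crux K1 child «MinimiserStabilityRegPr» (stmt-QuantumFields-19200), route-R E′ path (α′) — THE CURVED-JUNCTION LETTERS:
# (J-b) the DOOR's covariant divergence ∕ linearised plaquette AT `W` versus AT THE FLAT BACKGROUND, pointwise and summed, under `‖W_b − 1‖ ≤ w`;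
# (J-a) their Ad-covariance under a simultaneous gauge change; (J-c) the BCH row of a pinned re-gauging of the chart

Cell `ym3-torus` ∕ width seat `ym-ust-19200-w1` (gen 11; pen «w1: J-letters GO», ★p1 g14 2026-08-28 17:33Z, over the LOCATE memo `LOCATE-CURVED-JUNCTION-w1g11.md`).
THEOREMS ONLY (0 `def`, 0 `sorry`); `--supports stmt-QuantumFields-19200`, count-neutral.  YM₃ on T³ is a ladder rung (R3), not the Clay problem; nothing here claims
the stub, the crux, d = 4 or the mass gap.

WHY.  The path-(α) doors ✓`Prop7LocMinOfPinnedChartSlice.stub_PV3E_of_pinnedChartSliceM` ∕ `…_of_fibrePointSlice` read, per competitor, the slice inequality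
`DIV_W(D) ≤ ζ·K_W(D) + δ₁ℓ⁻²M(D)` in the COVARIANT letters of the background `W`: `DIV_W(D) = Σ_xΣ_jk|(divB (torusT …) (unitsField (toUField W)) (I•D))(x)_jk|²`,
`K_W(D) = Σ_p‖ℒ^W_p(D)‖²` with the four-term linearised plaquette `ℒ^W_p(D) = iD₁ + W₁(iD₂)W₁* − (W₁W₂W₃⁻¹)(iD₃)(W₁W₂W₃⁻¹)* − W(∂p)(iD₄)W(∂p)*`.  The flat rows of
the (α′) chain (★routeR-w3's LEMMA H ∕ (S_H-SUP′), px17's ENGINE) live at `W = 1`.  This file supplies the LETTERS any covariant re-run ends with (memo §1, §4(4)):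
 (J-b) in a gauge∕region where `‖W_b − 1‖ ≤ w` (e.g. W's comb axial gauge on a cell, `w = 3e·L^{−(K−n)}`, ✓`Prop7UntwistCornerData.dist1_combLoop_corner_le_T3`):
   `‖(D^*_W A)(x) − (D^*_1 A)(x)‖ ≤ 2·Σ_μ‖W(x−e_μ,μ) − 1‖·‖A_μ(x−e_μ)‖`, summed `Σ_x‖D^*_WA − D^*_1A‖²_HS ≤ 96w²·Σ_b‖A b‖²`, hence `DIV_W ≤ 2·DIV_1 + 192w²M` and
   `DIV_1 ≤ 2·DIV_W + 192w²M`; `‖ℒ^W_p(D) − ℒ^1_p(D)‖ ≤ 2w‖D₂‖ + 6w‖D₃‖ + 2π_p‖D₄‖` (`π_p = ‖W(∂p) − 1‖`) — every junction error is `O((w² + π²)·M)`, i.e. it lands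
   in the door's `δ₁ℓ⁻²M` slack with `δ₁ = O(e²)` (memo §1: ≥ 14 orders inside `δ₁ < 4κ_H`).
 (J-a) Ad-covariance under `(W, A) ↦ (W^σ, Ad_σA)` (`D^*_{W^σ}(Ad_σA)(x) = σ(x)·(D^*_WA)(x)·σ(x)*`, the chart `(Y^σ)_b(W^σ)_b⁻¹ = σ(b₋)·Y_bW_b⁻¹·σ(b₋)⁻¹`) — so the door's
   quantities may be computed in any gauge of the PAIR — is the sibling file `…Prop7CurvedJunctionCovariance`.
 (J-c) the BCH row of a pinned re-gauging `Y ↦ Y^{e^{−iψ}}` of a chart point: `‖log(e^Xe^Ye^Z) − (X + Y + Z)‖ ≤ 2(‖X‖+‖Y‖+‖Z‖)²` on `‖X‖+‖Y‖+‖Z‖ ≤ 1∕6`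
   (✓`B7Eq31BCH.eq31_of_sum_le` twice), read at `X = −iψ(b₋)`, `Y = iD_b`, `Z = i·W_bψ(b₊)W_b*`: the new chart is `D_b − ψ(b₋) + W_bψ(b₊)W_b*` up to `2(‖ψ(b₋)‖+‖D_b‖+‖ψ(b₊)‖)²`.

WHAT IS PROVED (ns `…Theorems.Prop7CurvedJunctionLetters`).  §1 `norm_star_mul_mul_sub_le`, `norm_mul3_sub_one_le`, ★`norm_mlog_exp3_sub_le` (BCH, three factors);
§2 `coe_one_apply`, `divB_one_apply`, ★`norm_divB_sub_divB_one_le`, ★★`sum_hs_divB_sub_divB_one_le`, `normSq_le_two_add_two`, ★`sum_hs_divB_le_two_mul_add` ∕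
`sum_hs_divB_one_le_two_mul_add`, ★`norm_linPlaq_sub_flat_le`; §3 ★`norm_hermLog_regauge_sub_le` (the (J-c) row in chart letters).  The Ad-covariance identities (J-a)
are the sibling file `…Prop7CurvedJunctionCovariance` (next).

HONEST SCOPE.  Letters only (pointwise algebra and Cauchy–Schwarz); no elliptic estimate, no statement about E′; the covariant re-runs of LEMMA H ∕ ENGINE ∕ hInterp are other pens.

References: T. Bałaban, CMP 99 (1985) 389–434 [Balaban1985BackgroundPropagators] ((3.3)–(3.9) pp.390–392); CMP 98 (1985) 17–51 [Balaban1985Averaging] ((19)–(21) p.21,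
(31) p.22); CMP 102 (1985) 277–309 [Balaban1985Variational] ((15) p.280, (116) p.295).
-/

noncomputable section

open scoped BigOperators Matrix.Norms.L2Operator Matrix

namespace Summit.QuantumFields.YangMills.Theorems.Prop7CurvedJunctionLetters

open NormedSpace
open Literature.MathematicalPhysics.QuantumFieldTheory.Balaban1983to89
open Literature.MathematicalPhysics.QuantumFieldTheory.Balaban1983to89.T3ContinuumYM3Torus
open Finset T4Continuum
open B9Eq39Adjoint (divB)
open B10Eq27TorusAxialLog (unitsField toUField)
open B9TorusCalculus (torusT)
open MatrixLog (mlog exp_mlog norm_mlog_le_two_mul)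
open Summit.QuantumFields.YangMills.Theorems.Prop7PointLandauDivergence (divB_apply)
open Summit.QuantumFields.YangMills.Theorems.Prop7PointLandauBudget (sum_incident_eq)
open Summit.QuantumFields.YangMills.Theorems.Prop7CovariantCoercivity (sum_norm_sq_le_mul_opNorm_sq)
open Summit.QuantumFields.YangMills.Theorems.Prop7GeodesicInterp (norm_exp_sub_one_le_three_mul)

/-! ## §1 Matrix algebra: conjugation by a near-identity unitary, triple products, BCH with three factors -/

section Algebra

variable {m : Type*} [Fintype m] [DecidableEq m]

/-- `‖U* X U − X‖ ≤ 2‖U − 1‖·‖X‖` for unitary `U`. [cite: Balaban1985Averaging, (19)-(21) p.21] -/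
theorem norm_star_mul_mul_sub_le {U : Matrix m m ℂ} (hU : U ∈ Matrix.unitaryGroup m ℂ) (X : Matrix m m ℂ) :
    ‖star U * X * U - X‖ ≤ 2 * ‖U - 1‖ * ‖X‖ := by
  have hid : star U * X * U - X = star U * X * (U - 1) + star (U - 1) * X := by
    rw [star_sub, star_one]; noncomm_ring
  rw [hid]
  have h1 : ‖star U * X * (U - 1)‖ ≤ ‖U - 1‖ * ‖X‖ := by
    calc ‖star U * X * (U - 1)‖ ≤ ‖star U * X‖ * ‖U - 1‖ := norm_mul_le _ _
      _ = ‖X‖ * ‖U - 1‖ := by rw [CStarRing.norm_mem_unitary_mul _ (Unitary.star_mem hU)]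
      _ = ‖U - 1‖ * ‖X‖ := mul_comm _ _
  have h2 : ‖star (U - 1) * X‖ ≤ ‖U - 1‖ * ‖X‖ := by
    calc ‖star (U - 1) * X‖ ≤ ‖star (U - 1)‖ * ‖X‖ := norm_mul_le _ _
      _ = ‖U - 1‖ * ‖X‖ := by rw [norm_star]
  calc ‖star U * X * (U - 1) + star (U - 1) * X‖ ≤ ‖star U * X * (U - 1)‖ + ‖star (U - 1) * X‖ := norm_add_le _ _
    _ ≤ 2 * ‖U - 1‖ * ‖X‖ := by linarith

/-- `‖ABC* − 1‖ ≤ ‖A − 1‖ + ‖B − 1‖ + ‖C − 1‖` for unitaries `A, B` and any `C`. [folklore] -/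
theorem norm_mul3_sub_one_le {A B C : Matrix m m ℂ} (hA : A ∈ Matrix.unitaryGroup m ℂ) (hB : B ∈ Matrix.unitaryGroup m ℂ) :
    ‖A * B * star C - 1‖ ≤ ‖A - 1‖ + ‖B - 1‖ + ‖C - 1‖ := by
  have hid : A * B * star C - 1 = A * B * star (C - 1) + (A * (B - 1) + (A - 1)) := by
    rw [star_sub, star_one]; noncomm_ring
  rw [hid]
  have h1 : ‖A * B * star (C - 1)‖ = ‖C - 1‖ := by
    rw [mul_assoc, CStarRing.norm_mem_unitary_mul _ hA, CStarRing.norm_mem_unitary_mul _ hB, norm_star]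
  have h2 : ‖A * (B - 1)‖ = ‖B - 1‖ := CStarRing.norm_mem_unitary_mul _ hA
  have h3 := norm_add_le (A * B * star (C - 1)) (A * (B - 1) + (A - 1))
  have h4 := norm_add_le (A * (B - 1)) (A - 1)
  linarith

/-- ★ **BCH WITH THREE FACTORS**: `‖log(e^X e^Y e^Z) − (X + Y + Z)‖ ≤ 2·(‖X‖ + ‖Y‖ + ‖Z‖)²` whenever `‖X‖ + ‖Y‖ + ‖Z‖ ≤ 1∕6` (✓`B7Eq31BCH.eq31_of_sum_le` twice).
[cite: Balaban1985Averaging, (31) p.22] -/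
theorem norm_mlog_exp3_sub_le (X Y Z : Matrix m m ℂ) (h : ‖X‖ + ‖Y‖ + ‖Z‖ ≤ 1 / 6) :
    ‖mlog (exp X * exp Y * exp Z) - (X + Y + Z)‖ ≤ 2 * (‖X‖ + ‖Y‖ + ‖Z‖) ^ 2 := by
  have hX := norm_nonneg X; have hY := norm_nonneg Y; have hZ := norm_nonneg Z
  -- the inner product `e^Y e^Z = e^V`, `V = log(e^Y e^Z)`
  have hYZ1 : ‖exp Y * exp Z - 1‖ < 1 := by
    have eY := norm_exp_sub_one_le_three_mul Y (by linarith)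
    have eZ := norm_exp_sub_one_le_three_mul Z (by linarith)
    have hid : exp Y * exp Z - 1 = (exp Y - 1) * (exp Z - 1) + (exp Y - 1) + (exp Z - 1) := by noncomm_ring
    rw [hid]
    have hA := norm_add_le ((exp Y - 1) * (exp Z - 1) + (exp Y - 1)) (exp Z - 1)
    have hB := norm_add_le ((exp Y - 1) * (exp Z - 1)) (exp Y - 1)
    have hC := norm_mul_le (exp Y - 1) (exp Z - 1)
    have hYn := norm_nonneg (exp Y - 1); have hZn := norm_nonneg (exp Z - 1)
    have hprod : ‖exp Y - 1‖ * ‖exp Z - 1‖ ≤ 3 * ‖Y‖ * (3 * ‖Z‖) := mul_le_mul eY eZ hZn (by linarith)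
    nlinarith
  set V := mlog (exp Y * exp Z) with hV
  have hV1 : ‖V - Y - Z‖ ≤ 2 * ‖Y‖ * ‖Z‖ := B7Eq31BCH.eq31_of_sum_le (by linarith)
  have hVn : ‖V‖ ≤ ‖Y‖ + ‖Z‖ + 2 * ‖Y‖ * ‖Z‖ := by
    have : V = (V - Y - Z) + (Y + Z) := by abel
    rw [this]
    calc ‖(V - Y - Z) + (Y + Z)‖ ≤ ‖V - Y - Z‖ + ‖Y + Z‖ := norm_add_le _ _
      _ ≤ 2 * ‖Y‖ * ‖Z‖ + (‖Y‖ + ‖Z‖) := add_le_add hV1 (norm_add_le _ _)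
      _ = ‖Y‖ + ‖Z‖ + 2 * ‖Y‖ * ‖Z‖ := by ring
  have hexpV : exp V = exp Y * exp Z := by rw [hV]; exact exp_mlog hYZ1
  have hXV : ‖X‖ + ‖V‖ ≤ 1 / 5 := by nlinarith
  have h2 : ‖mlog (exp X * exp V) - X - V‖ ≤ 2 * ‖X‖ * ‖V‖ := B7Eq31BCH.eq31_of_sum_le hXV
  rw [mul_assoc, ← hexpV]
  have hsplit : mlog (exp X * exp V) - (X + Y + Z) = (mlog (exp X * exp V) - X - V) + (V - Y - Z) := by abel
  rw [hsplit]
  calc ‖(mlog (exp X * exp V) - X - V) + (V - Y - Z)‖ ≤ 2 * ‖X‖ * ‖V‖ + 2 * ‖Y‖ * ‖Z‖ := (norm_add_le _ _).trans (add_le_add h2 hV1)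
    _ ≤ 2 * ‖X‖ * (‖Y‖ + ‖Z‖ + 2 * ‖Y‖ * ‖Z‖) + 2 * ‖Y‖ * ‖Z‖ := by gcongr
    _ ≤ 2 * (‖X‖ + ‖Y‖ + ‖Z‖) ^ 2 := by nlinarith [mul_nonneg hX hY, mul_nonneg hY hZ, mul_nonneg hX hZ, mul_nonneg (mul_nonneg hX hY) hZ]

end Algebra

/-! ## §2 The door's covariant divergence and linearised plaquette at `W` versus at the flat background -/

section T3

variable {F : T3Family} {K : ℕ}

/-- The bond variables of the trivial configuration are `1` (as matrices). [folklore] -/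
theorem coe_one_apply (b : PBond (F.P K) 0) :
    (((1 : GaugeField (F.P K) 0 (Matrix.specialUnitaryGroup (Fin 2) ℂ)) b : Matrix.specialUnitaryGroup (Fin 2) ℂ) : Matrix (Fin 2) (Fin 2) ℂ) = 1 := rfl

/-- **THE FLAT DIVERGENCE IN THE DOOR's LETTERS**: `(D^*_1 A)(x) = Σ_μ (A_μ(x − e_μ) − A_μ(x))`. [cite: Balaban1985BackgroundPropagators, (3.8) p.392] -/
theorem divB_one_apply (A : Fin (F.P K).d → Site (F.P K) 0 → Matrix (Fin 2) (Fin 2) ℂ) (x : Site (F.P K) 0) :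
    divB (torusT (F.P K) 0) (fun κ z => unitsField (toUField (1 : GaugeField (F.P K) 0 (Matrix.specialUnitaryGroup (Fin 2) ℂ))) ⟨z, κ⟩) A x
      = ∑ μ : Fin (F.P K).d, (A μ (x.unshift μ) - A μ x) := by
  rw [divB_apply]
  refine Finset.sum_congr rfl fun μ _ => ?_
  rw [coe_one_apply, star_one, one_mul, mul_one]

/-- ★ **COVARIANT VERSUS FLAT DIVERGENCE, POINTWISE**: `‖(D^*_W A)(x) − (D^*_1 A)(x)‖ ≤ 2·Σ_μ ‖W(x−e_μ,μ) − 1‖·‖A_μ(x−e_μ)‖`.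
[cite: Balaban1985BackgroundPropagators, (3.8) p.392] -/
theorem norm_divB_sub_divB_one_le (W : GaugeField (F.P K) 0 (Matrix.specialUnitaryGroup (Fin 2) ℂ))
    (A : Fin (F.P K).d → Site (F.P K) 0 → Matrix (Fin 2) (Fin 2) ℂ) (x : Site (F.P K) 0) :
    ‖divB (torusT (F.P K) 0) (fun κ z => unitsField (toUField W) ⟨z, κ⟩) A x
        - divB (torusT (F.P K) 0) (fun κ z => unitsField (toUField (1 : GaugeField (F.P K) 0 (Matrix.specialUnitaryGroup (Fin 2) ℂ))) ⟨z, κ⟩) A x‖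
      ≤ 2 * ∑ μ : Fin (F.P K).d, ‖((W ⟨x.unshift μ, μ⟩ : Matrix.specialUnitaryGroup (Fin 2) ℂ) : Matrix (Fin 2) (Fin 2) ℂ) - 1‖ * ‖A μ (x.unshift μ)‖ := by
  rw [divB_apply, divB_one_apply, ← Finset.sum_sub_distrib, Finset.mul_sum]
  refine (norm_sum_le _ _).trans (Finset.sum_le_sum fun μ _ => ?_)
  have hid : star ((W ⟨x.unshift μ, μ⟩ : Matrix.specialUnitaryGroup (Fin 2) ℂ) : Matrix (Fin 2) (Fin 2) ℂ) * A μ (x.unshift μ) *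
        ((W ⟨x.unshift μ, μ⟩ : Matrix.specialUnitaryGroup (Fin 2) ℂ) : Matrix (Fin 2) (Fin 2) ℂ) - A μ x - (A μ (x.unshift μ) - A μ x)
      = star ((W ⟨x.unshift μ, μ⟩ : Matrix.specialUnitaryGroup (Fin 2) ℂ) : Matrix (Fin 2) (Fin 2) ℂ) * A μ (x.unshift μ) *
        ((W ⟨x.unshift μ, μ⟩ : Matrix.specialUnitaryGroup (Fin 2) ℂ) : Matrix (Fin 2) (Fin 2) ℂ) - A μ (x.unshift μ) := by abel
  rw [hid]
  have h := norm_star_mul_mul_sub_le (W ⟨x.unshift μ, μ⟩).2.1 (A μ (x.unshift μ))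
  linarith

/-- ★★ **COVARIANT VERSUS FLAT DIVERGENCE IN `Σ_xΣ_jk|·|²`**: if `‖W_b − 1‖ ≤ w` on every bond then
`Σ_xΣ_jk|((D^*_W − D^*_1)A)(x)_jk|² ≤ 96w²·Σ_b‖A(b)‖²` (`HS ≤ 2·op²` on `M₂(ℂ)`, Cauchy–Schwarz over `d = 3`, both ends of every bond).
[cite: Balaban1985BackgroundPropagators, (3.8) p.392] -/
theorem sum_hs_divB_sub_divB_one_le (W : GaugeField (F.P K) 0 (Matrix.specialUnitaryGroup (Fin 2) ℂ)) {w : ℝ}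
    (hw : ∀ b : PBond (F.P K) 0, ‖((W b : Matrix.specialUnitaryGroup (Fin 2) ℂ) : Matrix (Fin 2) (Fin 2) ℂ) - 1‖ ≤ w)
    (A : PBond (F.P K) 0 → Matrix (Fin 2) (Fin 2) ℂ) :
    ∑ x : Site (F.P K) 0, ∑ j : Fin 2, ∑ k : Fin 2,
        ‖(divB (torusT (F.P K) 0) (fun κ z => unitsField (toUField W) ⟨z, κ⟩) (fun κ z => A ⟨z, κ⟩) x
          - divB (torusT (F.P K) 0) (fun κ z => unitsField (toUField (1 : GaugeField (F.P K) 0 (Matrix.specialUnitaryGroup (Fin 2) ℂ))) ⟨z, κ⟩) (fun κ z => A ⟨z, κ⟩) x) j k‖ ^ 2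
      ≤ 96 * w ^ 2 * ∑ b : PBond (F.P K) 0, ‖A b‖ ^ 2 := by
  have hd : ((F.P K).d : ℝ) = 3 := by norm_num [T3Family.P_d]
  have hper : ∀ x : Site (F.P K) 0, ∑ j : Fin 2, ∑ k : Fin 2,
        ‖(divB (torusT (F.P K) 0) (fun κ z => unitsField (toUField W) ⟨z, κ⟩) (fun κ z => A ⟨z, κ⟩) x
          - divB (torusT (F.P K) 0) (fun κ z => unitsField (toUField (1 : GaugeField (F.P K) 0 (Matrix.specialUnitaryGroup (Fin 2) ℂ))) ⟨z, κ⟩) (fun κ z => A ⟨z, κ⟩) x) j k‖ ^ 2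
      ≤ 48 * w ^ 2 * (∑ μ : Fin (F.P K).d, ‖A ⟨x, μ⟩‖ ^ 2 + ∑ μ : Fin (F.P K).d, ‖A ⟨x.unshift μ, μ⟩‖ ^ 2) := by
    intro x
    set E := divB (torusT (F.P K) 0) (fun κ z => unitsField (toUField W) ⟨z, κ⟩) (fun κ z => A ⟨z, κ⟩) x
          - divB (torusT (F.P K) 0) (fun κ z => unitsField (toUField (1 : GaugeField (F.P K) 0 (Matrix.specialUnitaryGroup (Fin 2) ℂ))) ⟨z, κ⟩) (fun κ z => A ⟨z, κ⟩) x
      with hE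
    have hHS := sum_norm_sq_le_mul_opNorm_sq E
    push_cast at hHS
    have hn : ‖E‖ ≤ ∑ μ : Fin (F.P K).d, 2 * w * ‖A ⟨x.unshift μ, μ⟩‖ := by
      refine (norm_divB_sub_divB_one_le W (fun κ z => A ⟨z, κ⟩) x).trans ?_
      rw [Finset.mul_sum]
      refine Finset.sum_le_sum fun μ _ => ?_
      have := hw ⟨x.unshift μ, μ⟩
      have hA := norm_nonneg (A ⟨x.unshift μ, μ⟩)
      nlinarith
    have h0 : 0 ≤ ‖E‖ := norm_nonneg _
    have hsq := pow_le_pow_left₀ h0 hn 2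
    have hCS := sq_sum_le_card_mul_sum_sq (s := (Finset.univ : Finset (Fin (F.P K).d))) (f := fun μ => 2 * w * ‖A ⟨x.unshift μ, μ⟩‖)
    rw [Finset.card_univ, Fintype.card_fin, hd] at hCS
    have hsum : ∑ μ : Fin (F.P K).d, (2 * w * ‖A ⟨x.unshift μ, μ⟩‖) ^ 2 = 4 * w ^ 2 * ∑ μ : Fin (F.P K).d, ‖A ⟨x.unshift μ, μ⟩‖ ^ 2 := by
      rw [Finset.mul_sum]; exact Finset.sum_congr rfl fun μ _ => by ring
    have hnn : 0 ≤ ∑ μ : Fin (F.P K).d, ‖A ⟨x, μ⟩‖ ^ 2 := Finset.sum_nonneg fun _ _ => by positivity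
    have hw2 : 0 ≤ w ^ 2 := by positivity
    nlinarith [hHS, hsq, hCS, hsum, mul_nonneg hw2 hnn]
  calc _ ≤ ∑ x : Site (F.P K) 0, 48 * w ^ 2 * (∑ μ : Fin (F.P K).d, ‖A ⟨x, μ⟩‖ ^ 2 + ∑ μ : Fin (F.P K).d, ‖A ⟨x.unshift μ, μ⟩‖ ^ 2) :=
        Finset.sum_le_sum fun x _ => hper x
    _ = 48 * w ^ 2 * (2 * ∑ b : PBond (F.P K) 0, ‖A b‖ ^ 2) := by rw [← Finset.mul_sum, sum_incident_eq (fun b => ‖A b‖ ^ 2)]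
    _ = 96 * w ^ 2 * ∑ b : PBond (F.P K) 0, ‖A b‖ ^ 2 := by ring

/-- `Σ|a|² ≤ 2Σ|b|² + 2Σ|a − b|²` entrywise (the triangle step used twice below). [folklore] -/
theorem normSq_le_two_add_two (a b : Matrix (Fin 2) (Fin 2) ℂ) (j k : Fin 2) : ‖a j k‖ ^ 2 ≤ 2 * ‖b j k‖ ^ 2 + 2 * ‖(a - b) j k‖ ^ 2 := by
  have h : b j k + (a - b) j k = a j k := by simp
  have hn : ‖a j k‖ ≤ ‖b j k‖ + ‖(a - b) j k‖ := by
    calc ‖a j k‖ = ‖b j k + (a - b) j k‖ := by rw [h]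
      _ ≤ ‖b j k‖ + ‖(a - b) j k‖ := norm_add_le _ _
  have h2 := mul_self_le_mul_self (norm_nonneg _) hn
  nlinarith [norm_nonneg (b j k), norm_nonneg ((a - b) j k), norm_nonneg (a j k), sq_nonneg (‖b j k‖ - ‖(a - b) j k‖)]

/-- ★ **`DIV_W ≤ 2·DIV_1 + 192w²·M`** (the curved divergence from the flat one). [cite: Balaban1985BackgroundPropagators, (3.8) p.392] -/
theorem sum_hs_divB_le_two_mul_add (W : GaugeField (F.P K) 0 (Matrix.specialUnitaryGroup (Fin 2) ℂ)) {w : ℝ}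
    (hw : ∀ b : PBond (F.P K) 0, ‖((W b : Matrix.specialUnitaryGroup (Fin 2) ℂ) : Matrix (Fin 2) (Fin 2) ℂ) - 1‖ ≤ w)
    (A : PBond (F.P K) 0 → Matrix (Fin 2) (Fin 2) ℂ) :
    ∑ x : Site (F.P K) 0, ∑ j : Fin 2, ∑ k : Fin 2,
        ‖(divB (torusT (F.P K) 0) (fun κ z => unitsField (toUField W) ⟨z, κ⟩) (fun κ z => A ⟨z, κ⟩) x) j k‖ ^ 2
      ≤ 2 * ∑ x : Site (F.P K) 0, ∑ j : Fin 2, ∑ k : Fin 2,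
          ‖(divB (torusT (F.P K) 0) (fun κ z => unitsField (toUField (1 : GaugeField (F.P K) 0 (Matrix.specialUnitaryGroup (Fin 2) ℂ))) ⟨z, κ⟩) (fun κ z => A ⟨z, κ⟩) x) j k‖ ^ 2
        + 192 * w ^ 2 * ∑ b : PBond (F.P K) 0, ‖A b‖ ^ 2 := by
  have h := sum_hs_divB_sub_divB_one_le W hw A
  have hpt : ∀ x : Site (F.P K) 0, ∑ j : Fin 2, ∑ k : Fin 2,
        ‖(divB (torusT (F.P K) 0) (fun κ z => unitsField (toUField W) ⟨z, κ⟩) (fun κ z => A ⟨z, κ⟩) x) j k‖ ^ 2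
      ≤ ∑ j : Fin 2, ∑ k : Fin 2, (2 * ‖(divB (torusT (F.P K) 0) (fun κ z => unitsField (toUField (1 : GaugeField (F.P K) 0 (Matrix.specialUnitaryGroup (Fin 2) ℂ))) ⟨z, κ⟩) (fun κ z => A ⟨z, κ⟩) x) j k‖ ^ 2
        + 2 * ‖(divB (torusT (F.P K) 0) (fun κ z => unitsField (toUField W) ⟨z, κ⟩) (fun κ z => A ⟨z, κ⟩) x
          - divB (torusT (F.P K) 0) (fun κ z => unitsField (toUField (1 : GaugeField (F.P K) 0 (Matrix.specialUnitaryGroup (Fin 2) ℂ))) ⟨z, κ⟩) (fun κ z => A ⟨z, κ⟩) x) j k‖ ^ 2) :=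
    fun x => Finset.sum_le_sum fun j _ => Finset.sum_le_sum fun k _ => normSq_le_two_add_two _ _ j k
  refine (Finset.sum_le_sum fun x _ => hpt x).trans ?_
  simp only [Finset.sum_add_distrib, ← Finset.mul_sum]
  linarith

/-- ★ **`DIV_1 ≤ 2·DIV_W + 192w²·M`** (the flat divergence from the curved one). [cite: Balaban1985BackgroundPropagators, (3.8) p.392] -/
theorem sum_hs_divB_one_le_two_mul_add (W : GaugeField (F.P K) 0 (Matrix.specialUnitaryGroup (Fin 2) ℂ)) {w : ℝ}
    (hw : ∀ b : PBond (F.P K) 0, ‖((W b : Matrix.specialUnitaryGroup (Fin 2) ℂ) : Matrix (Fin 2) (Fin 2) ℂ) - 1‖ ≤ w)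
    (A : PBond (F.P K) 0 → Matrix (Fin 2) (Fin 2) ℂ) :
    ∑ x : Site (F.P K) 0, ∑ j : Fin 2, ∑ k : Fin 2,
        ‖(divB (torusT (F.P K) 0) (fun κ z => unitsField (toUField (1 : GaugeField (F.P K) 0 (Matrix.specialUnitaryGroup (Fin 2) ℂ))) ⟨z, κ⟩) (fun κ z => A ⟨z, κ⟩) x) j k‖ ^ 2
      ≤ 2 * ∑ x : Site (F.P K) 0, ∑ j : Fin 2, ∑ k : Fin 2,
          ‖(divB (torusT (F.P K) 0) (fun κ z => unitsField (toUField W) ⟨z, κ⟩) (fun κ z => A ⟨z, κ⟩) x) j k‖ ^ 2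
        + 192 * w ^ 2 * ∑ b : PBond (F.P K) 0, ‖A b‖ ^ 2 := by
  have h := sum_hs_divB_sub_divB_one_le W hw A
  have hpt : ∀ x : Site (F.P K) 0, ∑ j : Fin 2, ∑ k : Fin 2,
        ‖(divB (torusT (F.P K) 0) (fun κ z => unitsField (toUField (1 : GaugeField (F.P K) 0 (Matrix.specialUnitaryGroup (Fin 2) ℂ))) ⟨z, κ⟩) (fun κ z => A ⟨z, κ⟩) x) j k‖ ^ 2
      ≤ ∑ j : Fin 2, ∑ k : Fin 2, (2 * ‖(divB (torusT (F.P K) 0) (fun κ z => unitsField (toUField W) ⟨z, κ⟩) (fun κ z => A ⟨z, κ⟩) x) j k‖ ^ 2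
        + 2 * ‖(divB (torusT (F.P K) 0) (fun κ z => unitsField (toUField W) ⟨z, κ⟩) (fun κ z => A ⟨z, κ⟩) x
          - divB (torusT (F.P K) 0) (fun κ z => unitsField (toUField (1 : GaugeField (F.P K) 0 (Matrix.specialUnitaryGroup (Fin 2) ℂ))) ⟨z, κ⟩) (fun κ z => A ⟨z, κ⟩) x) j k‖ ^ 2) := by
    intro x
    refine Finset.sum_le_sum fun j _ => Finset.sum_le_sum fun k _ => ?_
    have h1 := normSq_le_two_add_two
      (divB (torusT (F.P K) 0) (fun κ z => unitsField (toUField (1 : GaugeField (F.P K) 0 (Matrix.specialUnitaryGroup (Fin 2) ℂ))) ⟨z, κ⟩) (fun κ z => A ⟨z, κ⟩) x)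
      (divB (torusT (F.P K) 0) (fun κ z => unitsField (toUField W) ⟨z, κ⟩) (fun κ z => A ⟨z, κ⟩) x) j k
    rwa [← neg_sub, Matrix.neg_apply, norm_neg] at h1
  refine (Finset.sum_le_sum fun x _ => hpt x).trans ?_
  simp only [Finset.sum_add_distrib, ← Finset.mul_sum]
  linarith

/-- ★ **THE LINEARISED PLAQUETTE AT `W` VERSUS THE FLAT ONE, POINTWISE**: with `‖W_b − 1‖ ≤ w` on the bonds of `p` and `‖W(∂p) − 1‖ ≤ π`,
`‖ℒ^W_p(D) − (iD₁ + iD₂ − iD₃ − iD₄)‖ ≤ 2w‖D₂‖ + 6w‖D₃‖ + 2q‖D₄‖` (`q` the plaquette bound; the door's four-term expression, ✓`Prop7LocMinOfPinnedChartSlice` :230–:233).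
[cite: Balaban1985Variational, (116) p.295; Balaban1985BackgroundPropagators, (3.4) p.391] -/
theorem norm_linPlaq_sub_flat_le (W : GaugeField (F.P K) 0 (Matrix.specialUnitaryGroup (Fin 2) ℂ)) (D : PBond (F.P K) 0 → Matrix (Fin 2) (Fin 2) ℂ)
    (p : Plaq (F.P K) 0) {w q : ℝ}
    (h1 : ‖((W ⟨p.src, p.μ⟩ : Matrix.specialUnitaryGroup (Fin 2) ℂ) : Matrix (Fin 2) (Fin 2) ℂ) - 1‖ ≤ w)
    (h2 : ‖((W ⟨p.src.shift p.μ, p.ν⟩ : Matrix.specialUnitaryGroup (Fin 2) ℂ) : Matrix (Fin 2) (Fin 2) ℂ) - 1‖ ≤ w)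
    (h3 : ‖((W ⟨p.src.shift p.ν, p.μ⟩ : Matrix.specialUnitaryGroup (Fin 2) ℂ) : Matrix (Fin 2) (Fin 2) ℂ) - 1‖ ≤ w)
    (hπ : ‖((GaugeField.plaqHol W p : Matrix.specialUnitaryGroup (Fin 2) ℂ) : Matrix (Fin 2) (Fin 2) ℂ) - 1‖ ≤ q) :
    ‖((Complex.I • D ⟨p.src, p.μ⟩) + ((W ⟨p.src, p.μ⟩ : Matrix (Fin 2) (Fin 2) ℂ) * (Complex.I • D ⟨p.src.shift p.μ, p.ν⟩) * star (W ⟨p.src, p.μ⟩ : Matrix (Fin 2) (Fin 2) ℂ))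
        - (((W ⟨p.src, p.μ⟩ * W ⟨p.src.shift p.μ, p.ν⟩ * (W ⟨p.src.shift p.ν, p.μ⟩)⁻¹ : Matrix.specialUnitaryGroup (Fin 2) ℂ) : Matrix (Fin 2) (Fin 2) ℂ) *
            (Complex.I • D ⟨p.src.shift p.ν, p.μ⟩) *
            star (((W ⟨p.src, p.μ⟩ * W ⟨p.src.shift p.μ, p.ν⟩ * (W ⟨p.src.shift p.ν, p.μ⟩)⁻¹ : Matrix.specialUnitaryGroup (Fin 2) ℂ) : Matrix (Fin 2) (Fin 2) ℂ)))
        - (((GaugeField.plaqHol W p : Matrix.specialUnitaryGroup (Fin 2) ℂ) : Matrix (Fin 2) (Fin 2) ℂ) * (Complex.I • D ⟨p.src, p.ν⟩) *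
            star ((GaugeField.plaqHol W p : Matrix.specialUnitaryGroup (Fin 2) ℂ) : Matrix (Fin 2) (Fin 2) ℂ)))
      - ((Complex.I • D ⟨p.src, p.μ⟩) + (Complex.I • D ⟨p.src.shift p.μ, p.ν⟩) - (Complex.I • D ⟨p.src.shift p.ν, p.μ⟩) - (Complex.I • D ⟨p.src, p.ν⟩))‖
      ≤ 2 * w * ‖D ⟨p.src.shift p.μ, p.ν⟩‖ + 6 * w * ‖D ⟨p.src.shift p.ν, p.μ⟩‖ + 2 * q * ‖D ⟨p.src, p.ν⟩‖ := by
  -- abbreviations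
  set W₁ : Matrix (Fin 2) (Fin 2) ℂ := (W ⟨p.src, p.μ⟩ : Matrix (Fin 2) (Fin 2) ℂ) with hW₁
  set T : Matrix.specialUnitaryGroup (Fin 2) ℂ := W ⟨p.src, p.μ⟩ * W ⟨p.src.shift p.μ, p.ν⟩ * (W ⟨p.src.shift p.ν, p.μ⟩)⁻¹ with hT
  set Pl : Matrix.specialUnitaryGroup (Fin 2) ℂ := GaugeField.plaqHol W p with hPl
  set X₁ := Complex.I • D ⟨p.src, p.μ⟩
  set X₂ := Complex.I • D ⟨p.src.shift p.μ, p.ν⟩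
  set X₃ := Complex.I • D ⟨p.src.shift p.ν, p.μ⟩
  set X₄ := Complex.I • D ⟨p.src, p.ν⟩
  have hnI : ∀ M : Matrix (Fin 2) (Fin 2) ℂ, ‖Complex.I • M‖ = ‖M‖ := fun M => by rw [norm_smul, Complex.norm_I, one_mul]
  -- conjugation by a unitary `U` moves `X` by at most `2‖U − 1‖‖X‖`: `UXU* − X = U (X − U*XU) ...`; use the star-form lemma on `U*`
  have hconj : ∀ (U : Matrix (Fin 2) (Fin 2) ℂ), U ∈ Matrix.unitaryGroup (Fin 2) ℂ → ∀ X : Matrix (Fin 2) (Fin 2) ℂ, ‖U * X * star U - X‖ ≤ 2 * ‖U - 1‖ * ‖X‖ := by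
    intro U hU X
    have h := norm_star_mul_mul_sub_le (Unitary.star_mem hU) X
    rw [star_star] at h
    have hs : ‖star U - 1‖ = ‖U - 1‖ := by rw [← norm_star, star_sub, star_star, star_one]
    rwa [hs] at h
  have hid : (X₁ + W₁ * X₂ * star W₁ - (T : Matrix (Fin 2) (Fin 2) ℂ) * X₃ * star (T : Matrix (Fin 2) (Fin 2) ℂ) - (Pl : Matrix (Fin 2) (Fin 2) ℂ) * X₄ * star (Pl : Matrix (Fin 2) (Fin 2) ℂ))
        - (X₁ + X₂ - X₃ - X₄)
      = (W₁ * X₂ * star W₁ - X₂) - ((T : Matrix (Fin 2) (Fin 2) ℂ) * X₃ * star (T : Matrix (Fin 2) (Fin 2) ℂ) - X₃)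
        - ((Pl : Matrix (Fin 2) (Fin 2) ℂ) * X₄ * star (Pl : Matrix (Fin 2) (Fin 2) ℂ) - X₄) := by abel
  rw [hid]
  have e2 := hconj W₁ (W ⟨p.src, p.μ⟩).2.1 X₂
  have e3 := hconj (T : Matrix (Fin 2) (Fin 2) ℂ) T.2.1 X₃
  have e4 := hconj (Pl : Matrix (Fin 2) (Fin 2) ℂ) Pl.2.1 X₄
  have hT1 : ‖(T : Matrix (Fin 2) (Fin 2) ℂ) - 1‖ ≤ 3 * w := by
    have hc : (T : Matrix (Fin 2) (Fin 2) ℂ) = (W ⟨p.src, p.μ⟩ : Matrix (Fin 2) (Fin 2) ℂ) * (W ⟨p.src.shift p.μ, p.ν⟩ : Matrix (Fin 2) (Fin 2) ℂ) *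
        star ((W ⟨p.src.shift p.ν, p.μ⟩ : Matrix.specialUnitaryGroup (Fin 2) ℂ) : Matrix (Fin 2) (Fin 2) ℂ) := by
      rw [hT, Submonoid.coe_mul, Submonoid.coe_mul, Summit.QuantumFields.YangMills.Theorems.Prop7BlendSite.coe_inv_SU]
    rw [hc]
    have := norm_mul3_sub_one_le (C := ((W ⟨p.src.shift p.ν, p.μ⟩ : Matrix.specialUnitaryGroup (Fin 2) ℂ) : Matrix (Fin 2) (Fin 2) ℂ))
      (W ⟨p.src, p.μ⟩).2.1 (W ⟨p.src.shift p.μ, p.ν⟩).2.1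
    linarith
  rw [hnI] at e2 e3 e4
  have hX2 := norm_nonneg (D ⟨p.src.shift p.μ, p.ν⟩)
  have hX3 := norm_nonneg (D ⟨p.src.shift p.ν, p.μ⟩)
  have hX4 := norm_nonneg (D ⟨p.src, p.ν⟩)
  have t1 := norm_sub_le (W₁ * X₂ * star W₁ - X₂ - ((T : Matrix (Fin 2) (Fin 2) ℂ) * X₃ * star (T : Matrix (Fin 2) (Fin 2) ℂ) - X₃))
    ((Pl : Matrix (Fin 2) (Fin 2) ℂ) * X₄ * star (Pl : Matrix (Fin 2) (Fin 2) ℂ) - X₄)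
  have t2 := norm_sub_le (W₁ * X₂ * star W₁ - X₂) ((T : Matrix (Fin 2) (Fin 2) ℂ) * X₃ * star (T : Matrix (Fin 2) (Fin 2) ℂ) - X₃)
  have m2 : 2 * ‖W₁ - 1‖ * ‖D ⟨p.src.shift p.μ, p.ν⟩‖ ≤ 2 * w * ‖D ⟨p.src.shift p.μ, p.ν⟩‖ := by gcongr
  have m3 : 2 * ‖(T : Matrix (Fin 2) (Fin 2) ℂ) - 1‖ * ‖D ⟨p.src.shift p.ν, p.μ⟩‖ ≤ 6 * w * ‖D ⟨p.src.shift p.ν, p.μ⟩‖ := by nlinarith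
  have m4 : 2 * ‖(Pl : Matrix (Fin 2) (Fin 2) ℂ) - 1‖ * ‖D ⟨p.src, p.ν⟩‖ ≤ 2 * q * ‖D ⟨p.src, p.ν⟩‖ := by gcongr
  linarith

end T3

/-! ## §3 (J-c) The BCH row of a pinned re-gauging of the chart -/

section Regauge

variable {m : Type*} [Fintype m] [DecidableEq m]

/-- ★ **THE RE-GAUGED CHART TO FIRST ORDER.**  For the chart factor `e^{iD}` of a bond, a site rotation `e^{−iψ₋}` at its source and the transported rotation
`e^{i·Uψ₊U*}` at its target (`U` unitary — the bond variable of the background): the Hermitian logarithm of the re-gauged chart factor is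
`D − ψ₋ + Uψ₊U*` up to `2(‖ψ₋‖ + ‖D‖ + ‖ψ₊‖)²`, whenever `‖ψ₋‖ + ‖D‖ + ‖ψ₊‖ ≤ 1∕6`:
`‖(−i)·log(e^{−iψ₋}·e^{iD}·e^{iUψ₊U*}) − (D − ψ₋ + Uψ₊U*)‖ ≤ 2(‖ψ₋‖ + ‖D‖ + ‖ψ₊‖)²`.  (The (P-knit) reads `Y^σ_b·W_b⁻¹ = σ(b₋)·(Y_bW_b⁻¹)·(W_bσ(b₊)⁻¹W_b⁻¹)` with
`σ = e^{−iψ}`, `Y_bW_b⁻¹ = e^{iD_b}`.) [cite: Balaban1985Averaging, (31) p.22; Balaban1985Variational, (15) p.280] -/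
theorem norm_hermLog_regauge_sub_le {U : Matrix m m ℂ} (hU : U ∈ Matrix.unitaryGroup m ℂ) (D ψm ψp : Matrix m m ℂ)
    (h : ‖ψm‖ + ‖D‖ + ‖ψp‖ ≤ 1 / 6) :
    ‖(-Complex.I) • mlog (exp ((-Complex.I) • ψm) * exp (Complex.I • D) * exp (Complex.I • (U * ψp * star U))) - (D - ψm + U * ψp * star U)‖
      ≤ 2 * (‖ψm‖ + ‖D‖ + ‖ψp‖) ^ 2 := by
  have hn1 : ‖(-Complex.I) • ψm‖ = ‖ψm‖ := by rw [norm_smul, norm_neg, Complex.norm_I, one_mul]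
  have hn2 : ‖Complex.I • D‖ = ‖D‖ := by rw [norm_smul, Complex.norm_I, one_mul]
  have hn3 : ‖Complex.I • (U * ψp * star U)‖ = ‖ψp‖ := by
    rw [norm_smul, Complex.norm_I, one_mul]; exact T4AdjointCovarianceUnitary.opNorm_conj_unitary ⟨U, hU⟩ ψp
  have hsum : ‖(-Complex.I) • ψm‖ + ‖Complex.I • D‖ + ‖Complex.I • (U * ψp * star U)‖ ≤ 1 / 6 := by rw [hn1, hn2, hn3]; exact h
  have hB := norm_mlog_exp3_sub_le ((-Complex.I) • ψm) (Complex.I • D) (Complex.I • (U * ψp * star U)) hsum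
  rw [hn1, hn2, hn3] at hB
  have hid : (-Complex.I) • mlog (exp ((-Complex.I) • ψm) * exp (Complex.I • D) * exp (Complex.I • (U * ψp * star U))) - (D - ψm + U * ψp * star U)
      = (-Complex.I) • (mlog (exp ((-Complex.I) • ψm) * exp (Complex.I • D) * exp (Complex.I • (U * ψp * star U)))
          - ((-Complex.I) • ψm + Complex.I • D + Complex.I • (U * ψp * star U))) := by
    rw [smul_sub, smul_add, smul_add, smul_smul, smul_smul, smul_smul]
    have hII : (-Complex.I) * (-Complex.I) = -1 := by rw [neg_mul_neg, Complex.I_mul_I]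
    have hII' : (-Complex.I) * Complex.I = 1 := by rw [neg_mul, Complex.I_mul_I, neg_neg]
    rw [hII, hII', one_smul, one_smul, neg_one_smul]
    abel
  rw [hid, norm_smul, norm_neg, Complex.norm_I, one_mul]
  exact hB

end Regauge

end Summit.QuantumFields.YangMills.Theorems.Prop7CurvedJunctionLetters

end
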